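import Literature.Analysis.SegalBargmann.HermiteFourier
import HarnessLib

/-!
# Sup-norm of a Fourier eigenfunction is bounded by its `L¹` norm; the Hermite functions (Folland 1989, §1.7)

Topic `Analysis/SegalBargmann`; namespace `Literature.Analysis.SegalBargmann`.  A Schwartz function `f` on `ℝ^σ`
which is an eigenfunction of the Fourier transform with a unimodular eigenvalue, `𝓕 f = c • f`, `‖c‖ = 1`, satisfies
the pointwise bound `‖f(x)‖ ≤ ∫ ‖f‖` (Riemann–Lebesgue / Mathlib `SchwartzMap.norm_fourier_apply_le_toLp_one`
applied to `f` itself).  By `HermiteFourier.fourier_hermiteSchwartz_herm` (`𝓕 h_α = (−i)^{|α|} h_α`) this applies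
to every Hermite function:

* `norm_apply_le_integral_norm_of_fourier_eq_smul` — the general statement;
* `norm_hermiteSchwartz_herm_apply_le` — `‖h_α(x)‖ ≤ ∫ ‖h_α‖ = ‖h_α‖_{L¹}` for every `x ∈ ℝ^σ` and every multi-index
  `α`.

This is the first step of the sup-norm / Schwartz-seminorm growth bounds for the Hermite functions (the hard half of
the `N`-representation theorem for `𝒮(ℝⁿ)`, Reed–Simon I Thm V.13): it reduces sup-norm bounds to weighted `L²`
bounds, which are ladder algebra.  Everything is proved from Mathlib and the imported tree files.

## References

* G. B. Folland, *Harmonic Analysis in Phase Space*, Annals of Mathematics Studies 122, Princeton UP (1989), §1.7.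
  [cite: Folland1989, §1.7]

## Provenance

Written for the tree under the LEAN-IN-TREE rule (2026-08-18) by the pub-hodgecm formalisation cell (model-construction
sub-cell, seat mc-binder-2).
-/

set_option autoImplicit false

noncomputable section

open MvPolynomial Complex SchwartzMap MeasureTheory FourierTransform
open scoped BigOperators Real FourierTransform

namespace Literature.Analysis.SegalBargmann

variable {σ : Type*} [Fintype σ] [DecidableEq σ]

omit [DecidableEq σ] in
/-- **A unimodular Fourier eigenfunction is pointwise bounded by its `L¹` norm**: if `𝓕 f = c • f` with `‖c‖ = 1`
then `‖f x‖ ≤ ∫ ‖f‖` for every `x` (Mathlib: `‖𝓕 f x‖ ≤ ‖f‖_{L¹}`). [folklore] -/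
theorem norm_apply_le_integral_norm_of_fourier_eq_smul (f : 𝓢(EuclideanSpace ℝ σ, ℂ)) {c : ℂ} (hc : ‖c‖ = 1)
    (hf : 𝓕 f = c • f) (x : EuclideanSpace ℝ σ) :
    ‖f x‖ ≤ ∫ y : EuclideanSpace ℝ σ, ‖f y‖ := by
  have h := SchwartzMap.norm_fourier_apply_le_toLp_one f x
  rw [hf, smul_apply, norm_smul, hc, one_mul, SchwartzMap.norm_toLp_one] at h
  exact h

/-- **`‖h_α(x)‖ ≤ ‖h_α‖_{L¹}`** for every Hermite function `h_α = hermiteSchwartz (herm α)` and every `x ∈ ℝ^σ`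
(from `𝓕 h_α = (−i)^{|α|} h_α`). [cite: Folland1989, §1.7] -/
theorem norm_hermiteSchwartz_herm_apply_le (α : σ →₀ ℕ) (x : EuclideanSpace ℝ σ) :
    ‖hermiteSchwartz (herm α) x‖ ≤ ∫ y : EuclideanSpace ℝ σ, ‖hermiteSchwartz (herm α) y‖ :=
  norm_apply_le_integral_norm_of_fourier_eq_smul _ (by rw [norm_pow, norm_neg, norm_I, one_pow])
    (fourier_hermiteSchwartz_herm α) x

end Literature.Analysis.SegalBargmann

end
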